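import Literature.AnabelianGeometry.EtaleTheta.LogDivisorModelTateTowerKummerTwistCnst
import Literature.AnabelianGeometry.EtaleTheta.Discharge.Sec3Cor38KummerTwistTower
import Literature.AnabelianGeometry.EtaleTheta.Discharge.Sec3Prop34Cnst0NoConstKummerTwistTower
import Literature.AnabelianGeometry.EtaleTheta.Discharge.Sec3Prop34CnstOfGaloisCovering
import HarnessLib

/-!
# [EtTh] Prop. 3.4 (ii) at the ζ-TWISTED Kummer–Tate tower: `Prop34Cnst₀` HOLDS for print's NON-CONSTANT constant-field functor
# `Y ↦ Spec K_Y` — the three naturality clauses relative to `D^cnst = 𝓑(G_K)⁰`, NO binder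

S. Mochizuki, *The étale theta function …*, Publ. RIMS **45** (2009) [MochizukiEtTh2009], §3 p.72 (the functor `D₀ → D^cnst`),
Prop. 3.4 (ii) p.74 («natural isomorphisms … `O_L^× ⥲ Ker(B₀(Y^log) → Φ₀^gp(Y^log))` … `L^× ⥲ F₀(Y^log)`»), Thm. 3.7 (iii) p.80
(«`Aut(L/K)` acts faithfully on `O_L^×`») [cite: MochizukiEtTh2009, Prop 3.4 (ii) p.74].

PROOF-ONLY companion (theorems only; abc-iut cell, layer L2; abc-iut-L2-lead gen 7 rows R914/R921/R936 «PROP34CNST₀ WITH NON-CONSTANT `D^cnst`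
AT THE TWISTED TOWER» — row holder abc-iut-w6-d057 gen 4, design = the lead's SPEC OF RECORD (R936), file prepared by abc-iut-w5-d179 gen 8) of `LogDivisorModelTateTowerKummerTwistCnst.lean` (the functor
`TateTowerKummerTwist.cnst : B^temp(Compat)⁰ ⥤ CosetCat C`, `Y ↦ C/Gal(K̄/K_Y)`).  abc-iut-L2-d2 showed (p483973,
`TateTowerKummerTwist.not_prop34Cnst₀_const`) that at the ζ-twisted tower `towerC` (p478618) abc-iut-L2-t3's bundle
`DivisorMonoids.Prop34Cnst₀ (DivisorMonoids.ofTower towerC) cnst` FAILS for every CONSTANT `cnst`, because the recorded roots of unity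
MOVE along covering maps.  Here, consuming BY NAME abc-iut-L2-d2's level calculus (`snd_apply_eq_of_mem_fZero`,
`divAt_eq_constDIV_actionOf`, `rho_eq_one_of_mem_vSub`, `lvlC_quotV`, `actFn_conjC_zeta`) and abc-iut-w6-d058's
`exists_bZero_of_stab_invariant`:
* §1 level calculus of constants: on a constant `β = (ζ, ϖ^c)` an element `m ∈ Compat` acts by its CHARACTER only
  (`actFn_of_mem_const`); the root-of-unity coordinate of a constant family at any point is DEFINED OVER `K_Y`
  (`fst_apply_mem_fixedRoots`); the value of a family along a covering map at a transported point (`apply_hom_ρ_bpt`);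
* §2 **`prop34Cnst₀_cnst : (DivisorMonoids.ofTower towerC).Prop34Cnst₀ cnst`** — ALL THREE CLAUSES PROVED, NO BINDER:
  (1) covering maps `g, g'` with `cnst g = cnst g'` have transporters `a, a'` with `χ(a⁻¹a') ∈ Gal(K̄/K_{Y'})`, which fixes the
  root-of-unity coordinate of every constant of `Y'`, so the pull-backs of constants agree (also after the level change `resFn`);
  (2) divisors of constants are the multiples `c·Σ_j[F_j]` of the special fibre, pulled back identically by ANY two maps;
  (3) automorphisms agreeing on `Ker(B₀(Y) → Φ₀(Y)^gp)` agree on the family `x·p ↦ x·ζ` through every root of unity `ζ` defined over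
  `K_Y` (it EXISTS: `exists_bZero_of_stab_invariant`; its divisor is trivial), hence `χ_{lvl Y}(a⁻¹a')` fixes `fixedRoots Y (lvl Y)`,
  which for the COMPATIBLE element `a⁻¹a'` is membership in `Gal(K̄/K_Y)` (`toCst_mem_cnstStab_iff`) — EXACTLY print's «`Aut(K_Y/K)`
  acts faithfully on `O^×_{K_Y} ⊇ μ(K_Y)`» at a model whose only units are roots of unity;
* §3 NON-CONSTANCY of `cnst` (the content p483973 asks for): at `Y₂ = Compat/V_2` (`quotCoverC (vSub 2) …`) (level `2`, constants `μ_6 × ⟨ϖ_2⟩`) the deck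
  transformation by `conjC` (character `−1`) and the identity have DIFFERENT images under `cnst` (`cnst_map_deck_ne_id`), since
  `χ(conjC) ∉ Gal(K̄/K_{Y₂})` (`toCst_conjC_not_mem_cnstStab`).
With this the hypothesis `h₀ : Prop34Cnst₀ cnst` of the Thm. 3.7 knits (`thm37_ofRankOneObjectR_of_inputs`, `D^cnst = 𝓑(G_K)⁰`, `C`
compact) is DISCHARGED at the twisted model by a functor through which Thm. 3.7 (iii) has CONTENT (non-trivial `Aut_{D^cnst}`).
HONEST FRAMING: theorems about OUR class-(b) design model over typed interfaces; refereed pre-IUT material; nothing here bears on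
[IUTchIII] Cor. 3.12; no side taken; typed ≠ proved — here proved.
-/

noncomputable section

namespace Literature.AnabelianGeometry.EtaleTheta

open CategoryTheory Opposite Function Literature.AlgebraicGeometry.Frobenioids Literature.AnabelianGeometry.SemiGraphs
  Literature.AlgebraicGeometry.Frobenioids.QuasiTemperoid LogDivisorModel LogDivisorModel.GaloisAction LogDivisorModel.TateTower
  LogDivisorModel.TateTowerTwist LogDivisorTower TateTowerFrd

namespace TateTowerKummerTwist

/-! ## §1 Level calculus of constants under `Compat` -/

/-- **On a constant `β = (ζ, ϖ^c)` of level `l` an element of `Compat` acts through its CHARACTER only**: `m · (ζ, ϖ^c) =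
(χ_l(m) ζ, ϖ^c)` (the Kummer twist sees the `U`-exponent `0`, the shear fixes `ϖ^c`). [cite: MochizukiEtTh2009, Def 3.3 p.73] -/
theorem actFn_of_mem_const (l : ℕ) (m : Compat) {β : Fn (MuN l)} (hβ : β ∈ (model (MuN l)).const) :
    (actC l).actFn m β = (chiN l (toCst m) β.1, β.2) := by
  have hk := (mem_const_iff (MuN l) β).1 hβ
  rw [actC_actFn_apply, actFnHom_apply, rho_right, rho_left]
  refine Prod.ext ?_ (Multiplicative.toAdd.injective (Prod.ext ?_ ?_))
  · change chiN l ((m : Grp)).1.right β.1 * kumN l ((m : Grp)).1.left ^ (Multiplicative.toAdd β.2).2 = chiN l (toCst m) β.1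
    rw [hk, zpow_zero, mul_one, toCst_apply]
  · change (Multiplicative.toAdd (shearFn (Multiplicative.toAdd ((m : Grp)).2) β.2)).1 = (Multiplicative.toAdd β.2).1
    rw [toAdd_shearFn, hk, zero_mul, sub_zero]
  · change (Multiplicative.toAdd (shearFn (Multiplicative.toAdd ((m : Grp)).2) β.2)).2 = (Multiplicative.toAdd β.2).2
    rw [toAdd_shearFn]

/-- `m · ζ = χ_l(m) ζ` on the roots of unity of level `l`. [cite: MochizukiEtTh2009, §1 p.13] -/
theorem actFn_zeta (l : ℕ) (m : Compat) (ζ : MuN l) : (actC l).actFn m (zeta (MuN l) ζ) = zeta (MuN l) (chiN l (toCst m) ζ) :=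
  actFn_of_mem_const l m (zeta_mem_const (MuN l) ζ)

/-- **The root-of-unity coordinate of a constant family is DEFINED OVER `K_Y`**: for `b ∈ F₀(Y)` and any point `y₀`, `(b y₀)_μ ∈
fixedRoots Y l` — a stabiliser of `x·y₀` fixes `b(x·y₀) = (χ(x)(b y₀)_μ, ·)`, and characters commute. [cite: MochizukiEtTh2009, Prop 3.4 (ii) p.74] -/
theorem fst_apply_mem_fixedRoots {l : ℕ} {Y : ConnectedPart (BTemp Compat)} (b : (actC l).bZero (gset Y)) (hb : b ∈ (actC l).fZero (gset Y))
    (y₀ : (gset Y).V) : (b.1 y₀).1 ∈ fixedRoots Y l := by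
  intro g₀ y hy
  obtain ⟨x, rfl⟩ := BTempConnected.exists_ρ_eq_of_isConnectedObj Y.obj Y.property y₀ y
  have e1 : b.1 ((gset Y).ρ x y₀) = (actC l).actFn x (b.1 y₀) := b.2.2 x y₀
  have e2 : b.1 ((gset Y).ρ g₀ ((gset Y).ρ x y₀)) = (actC l).actFn g₀ (b.1 ((gset Y).ρ x y₀)) := b.2.2 g₀ _
  rw [hy, e1, actFn_of_mem_const l g₀ ((actC l).act_mem_const x (hb y₀)), actFn_of_mem_const l x (hb y₀)] at e2
  have e3 := congrArg Prod.fst e2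
  change chiN l (toCst x) (b.1 y₀).1 = chiN l (toCst g₀) (chiN l (toCst x) (b.1 y₀).1) at e3
  rw [chiN_comm] at e3
  exact ((chiN l (toCst x)).injective e3).symm

/-- **Values along a covering map at transported points**: for `f : Y → Y'` with transporter `a` (`a·p' = f(p)`) and `b ∈ B₀(Y')`,
`b(f(x·p)) = (x a)·b(p')`. [cite: MochizukiEtTh2009, Def 3.3 (iii) p.74] -/
theorem apply_hom_ρ_bpt {l : ℕ} {Y Y' : ConnectedPart (BTemp Compat)} (f : Y ⟶ Y') (b : (actC l).bZero (gset Y')) (x : Compat)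
    {a : Compat} (ha : (gset Y').ρ a (bpt Y') = f.hom.hom.hom (bpt Y)) :
    b.1 (f.hom.hom.hom ((gset Y).ρ x (bpt Y))) = (actC l).actFn (x * a) (b.1 (bpt Y')) := by
  rw [BTempConnected.hom_ρ f.hom, ← ha, ← BTempConnected.ρ_mul_apply Y'.obj]
  exact b.2.2 _ _

/-- `Y` is a connected `Compat`-set in the sense of abc-iut-w6-d058's `isConnectedGSet` (nonempty, one orbit).
[cite: MochizukiFrdII2008, Ex 1.3 (ii) p.11] -/
theorem isConnectedGSet_gset (Y : ConnectedPart (BTemp Compat)) : isConnectedGSet (gset Y) :=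
  ⟨⟨bpt Y⟩, BTempConnected.exists_ρ_eq_of_isConnectedObj Y.obj Y.property⟩

/-- **Every root of unity defined over `K_Y` is the value of a UNIT constant family**: for `ζ ∈ fixedRoots Y (lvl Y)` there is
`b ∈ B₀(Y)` with `div₀ b = 1` and `b(x·p) = (χ(x)ζ, 1)`. [cite: MochizukiEtTh2009, Prop 3.4 (ii) p.74] -/
theorem exists_bZero_zeta {Y : ConnectedPart (BTemp Compat)} {ζ : MuN (lvlC Y)} (hζ : ζ ∈ fixedRoots Y (lvlC Y)) :
    ∃ b : (actC (lvlC Y)).bZero (gset Y), (actC (lvlC Y)).divZeroHom (gset Y) b = 1 ∧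
      ∀ x : Compat, b.1 ((gset Y).ρ x (bpt Y)) = zeta (MuN (lvlC Y)) (chiN (lvlC Y) (toCst x) ζ) := by
  obtain ⟨b, hb1, hb⟩ := (actC (lvlC Y)).exists_bZero_of_stab_invariant (gset Y) (isConnectedGSet_gset Y) (bpt Y)
    (u := zeta (MuN (lvlC Y)) ζ) ⟨le_rfl, rfl⟩ ⟨le_rfl, rfl⟩ (fun h hh => by rw [actFn_zeta, hζ h (bpt Y) hh])
  exact ⟨b, hb1, fun x => by rw [hb x, actFn_zeta]⟩

/-! ## §2 `Prop34Cnst₀` for the non-constant functor `cnst` — all three clauses, no binder -/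

/-- **Clause 1, pointwise**: covering maps `g, g'` with `cnst g = cnst g'` pull every constant family `b ∈ F₀(Y')` back to the SAME
function (before the level change): `χ(a⁻¹a') ∈ Gal(K̄/K_{Y'})` fixes the root-of-unity coordinate of `b`. [cite: MochizukiEtTh2009, Prop 3.4 (ii) p.74] -/
theorem apply_hom_eq_of_cnst_map_eq {Y Y' : ConnectedPart (BTemp Compat)} (g g' : Y ⟶ Y') (h : cnst.map g = cnst.map g')
    (b : (actC (lvlC Y')).bZero (gset Y')) (hb : b ∈ (actC (lvlC Y')).fZero (gset Y')) (s : (gset Y).V) :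
    b.1 (g.hom.hom.hom s) = b.1 (g'.hom.hom.hom s) := by
  have hst := (cnst_map_eq_iff g g' (ρ_transp g) (ρ_transp g')).1 h
  have hfix : (actC (lvlC Y')).actFn ((transp g)⁻¹ * transp g') (b.1 (bpt Y')) = b.1 (bpt Y') := by
    rw [actFn_of_mem_const _ _ (hb (bpt Y'))]
    exact Prod.ext ((toCst_mem_cnstStab_iff Y' _).1 hst _ (fst_apply_mem_fixedRoots b hb (bpt Y'))) rfl
  obtain ⟨x, rfl⟩ := BTempConnected.exists_ρ_eq_of_isConnectedObj Y.obj Y.property (bpt Y) s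
  rw [apply_hom_ρ_bpt g b x (ρ_transp g), apply_hom_ρ_bpt g' b x (ρ_transp g'), ← mul_inv_cancel_left (transp g) (transp g'),
    ← mul_assoc, map_mul (actC (lvlC Y')).actFn (x * transp g) ((transp g)⁻¹ * transp g'), MulAut.mul_apply, hfix]

/-- **Clause 1 of `Prop34Cnst₀` at the ζ-twisted tower**: `L^× ⥲ F₀(Y)` is natural relative to `D^cnst` — covering maps with the same
image under `cnst` pull constants back identically (also after the level change). [cite: MochizukiEtTh2009, Prop 3.4 (ii) p.74] -/
theorem B₀_map_eq_of_cnst_map_eq {Y Y' : ConnectedPart (BTemp Compat)} (g g' : Y ⟶ Y') (h : cnst.map g = cnst.map g')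
    (b : (DivisorMonoids.ofTower towerC).B₀.obj (op Y')) (hb : b ∈ (DivisorMonoids.ofTower towerC).F₀ (op Y')) :
    ((DivisorMonoids.ofTower towerC).B₀.map g.op).hom b = ((DivisorMonoids.ofTower towerC).B₀.map g'.op).hom b := by
  refine Subtype.ext (funext fun s => ?_)
  change towerC.resFn _ (b.1 (g.hom.hom.hom s)) = towerC.resFn _ (b.1 (g'.hom.hom.hom s))
  rw [apply_hom_eq_of_cnst_map_eq g g' h b hb s]

/-- **Clause 2 of `Prop34Cnst₀` at the ζ-twisted tower** (in fact for ANY two covering maps): the divisor of a constant family is a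
multiple `c·Σ_j[F_j]` of the special fibre, pulled back identically. [cite: MochizukiEtTh2009, Prop 3.4 (ii) p.74] -/
theorem Φ₀_map_eq_of_divisor_of_const {Y Y' : ConnectedPart (BTemp Compat)} (g g' : Y ⟶ Y')
    (x : (DivisorMonoids.ofTower towerC).Φ₀.obj (op Y'))
    (hx : ∃ b ∈ (DivisorMonoids.ofTower towerC).F₀ (op Y'), (DivisorMonoids.ofTower towerC).div₀ (op Y') b = Algebra.GrothendieckGroup.of x) :
    ((DivisorMonoids.ofTower towerC).Φ₀.map g.op).hom x = ((DivisorMonoids.ofTower towerC).Φ₀.map g'.op).hom x := by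
  obtain ⟨b, hb, hbx⟩ := hx
  obtain ⟨⟨s₀⟩, htrans⟩ := (BTemp.isConnectedObj_iff Y'.obj).mp Y'.property
  have hc := snd_apply_eq_of_mem_fZero ((rho (lvlC Y')).comp compat.subtype) (gset Y') htrans s₀ b hb
  have hdiv : ∀ s, x.1 s = (constDIV (Multiplicative.toAdd (b.1 s₀).2).1 : TateTower.model.DIV) := fun s => by
    have e := ((actC (lvlC Y')).divZeroHom_eq_div_iff (gset Y') b x 1).1 (by rw [map_one, div_one]; exact hbx) s
    rw [← e, OneMemClass.coe_one, Pi.one_apply, mul_one]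
    exact divAt_eq_constDIV_actionOf _ _ b s _ (hc s)
  refine Subtype.ext (funext fun s => ?_)
  change towerC.resDIV _ (x.1 (g.hom.hom.hom s)) = towerC.resDIV _ (x.1 (g'.hom.hom.hom s))
  rw [hdiv, hdiv]

/-- **Clause 3 of `Prop34Cnst₀` at the ζ-twisted tower** — print's «`Aut(K_Y/K)` acts faithfully on `O^×_{K_Y}`»: automorphisms of `Y`
agreeing on `Ker(B₀(Y) → Φ₀(Y)^gp)` agree on the unit family through every root of unity defined over `K_Y`, hence have the same image
in `Aut(Spec K_Y)`. [cite: MochizukiEtTh2009, Thm 3.7 (iii) p.80] -/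
theorem cnst_map_eq_of_B₀_map_eq {Y : ConnectedPart (BTemp Compat)} (g g' : Y ≅ Y)
    (H : ∀ b : (DivisorMonoids.ofTower towerC).B₀.obj (op Y), (DivisorMonoids.ofTower towerC).div₀ (op Y) b = 1 →
      ((DivisorMonoids.ofTower towerC).B₀.map g.hom.op).hom b = ((DivisorMonoids.ofTower towerC).B₀.map g'.hom.op).hom b) :
    cnst.map g.hom = cnst.map g'.hom := by
  refine (cnst_map_eq_iff g.hom g'.hom (ρ_transp g.hom) (ρ_transp g'.hom)).2 ((toCst_mem_cnstStab_iff Y _).2 fun ζ hζ => ?_)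
  obtain ⟨b, hb1, hb⟩ := exists_bZero_zeta hζ
  have e := congrArg (fun β : (towerC.act (levelsC.lvl Y)).bZero (gset Y) => β.1 (bpt Y)) (H b hb1)
  change towerC.resFn _ (b.1 (g.hom.hom.hom.hom (bpt Y))) = towerC.resFn _ (b.1 (g'.hom.hom.hom.hom (bpt Y))) at e
  rw [← ρ_transp g.hom, ← ρ_transp g'.hom, hb, hb] at e
  have e' := congrArg Prod.fst (towerC.resFn_injective _ e)
  change chiN (lvlC Y) (toCst (transp g.hom)) ζ = chiN (lvlC Y) (toCst (transp g'.hom)) ζ at e'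
  rw [map_mul, map_inv, map_mul, map_inv, MulAut.mul_apply, ← e', ← MulAut.mul_apply, inv_mul_cancel, MulAut.one_apply]

/-- **[EtTh] Prop. 3.4 (ii), naturality relative to `D^cnst`, HOLDS at the ζ-twisted Kummer–Tate tower for the functor
`Y ↦ Spec K_Y`**: `Prop34Cnst₀ (DivisorMonoids.ofTower towerC) cnst`, all three clauses PROVED, NO binder (cf. `not_prop34Cnst₀_const`:
it fails for every constant functor). [cite: MochizukiEtTh2009, Prop 3.4 (ii) p.74] -/
theorem prop34Cnst₀_cnst : (DivisorMonoids.ofTower towerC).Prop34Cnst₀ cnst where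
  B₀_map_eq_of_cnst_map_eq g g' h b hb := B₀_map_eq_of_cnst_map_eq g g' h b hb
  Φ₀_map_eq_of_cnst_map_eq g g' _ x hx := Φ₀_map_eq_of_divisor_of_const g g' x hx
  cnst_map_eq_of_B₀_map_eq g g' H := cnst_map_eq_of_B₀_map_eq g g' H

/-- `Prop34Cnst₀` is inhabited at the ζ-twisted tower by a (necessarily non-constant) functor to `𝓑(C)⁰`. [cite: MochizukiEtTh2009, Prop 3.4 (ii) p.74] -/
theorem exists_prop34Cnst₀ : ∃ F : ConnectedPart (BTemp Compat) ⥤ CosetCat Cst, (DivisorMonoids.ofTower towerC).Prop34Cnst₀ F :=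
  ⟨cnst, prop34Cnst₀_cnst⟩

/-! ## §3 `cnst` is NOT constant: the deck transformation by `conjC` of `Compat/V_2` moves `Spec K_{Y₂}` -/

/-- Every root of unity of level `lvl Y₂ = 2` is defined over `K_{Y₂}` (`V_2` acts trivially at level `2`; stabilisers are `V_2`).
[cite: MochizukiEtTh2009, §1 p.13] -/
theorem fixedRoots_quotV2 (ζ : MuN (lvlC (quotCoverC (vSub 2) (isOpen_vSub 2) (countable_quotient_vSub 2)))) :
    ζ ∈ fixedRoots (quotCoverC (vSub 2) (isOpen_vSub 2) (countable_quotient_vSub 2)) (lvlC (quotCoverC (vSub 2) (isOpen_vSub 2) (countable_quotient_vSub 2))) := by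
  set quotV2 : ConnectedPart (BTemp Compat) := (quotCoverC (vSub 2) (isOpen_vSub 2) (countable_quotient_vSub 2))
  intro g y hy
  induction y using QuotientGroup.induction_on with
  | H x =>
    have hg : x⁻¹ * g * x ∈ vSub 2 := (ofMulAction_quot_fix_iff (vSub 2) x g).1 hy
    have hg' : g ∈ vSub 2 := by
      have h := (vSub_normal 2).conj_mem _ hg x
      rwa [← mul_assoc, ← mul_assoc, mul_inv_cancel, one_mul, mul_inv_cancel_right] at h
    have h1 : rho (lvlC quotV2) (g : Grp) = 1 := rho_eq_one_of_mem_vSub (lvlC_quotV 2).le hg'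
    have h2 : chiN (lvlC quotV2) (toCst g) = 1 := by rw [toCst_apply, ← rho_right, h1]; rfl
    rw [h2, MulAut.one_apply]

/-- **`χ(conjC) ∉ Gal(K̄/K_{Y₂})`**: complex conjugation inverts `ζ₆ ∈ K_{Y₂}`. [cite: MochizukiEtTh2009, §1 p.13] -/
theorem toCst_conjC_not_mem_cnstStab : toCst conjC ∉ cnstStab (quotCoverC (vSub 2) (isOpen_vSub 2) (countable_quotient_vSub 2)) := by
  intro h
  set quotV2 : ConnectedPart (BTemp Compat) := (quotCoverC (vSub 2) (isOpen_vSub 2) (countable_quotient_vSub 2))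
  have hl : lvlC quotV2 = 2 := lvlC_quotV 2
  have key := (toCst_mem_cnstStab_iff quotV2 conjC).1 h (Multiplicative.ofAdd 1) (fixedRoots_quotV2 _)
  have key' := congrArg (zeta (MuN (lvlC quotV2))) key
  rw [← actFn_zeta, actFn_conjC_zeta] at key'
  have key2 := congrArg (fun z : Fn (MuN (lvlC quotV2)) => Multiplicative.toAdd z.1) key'
  change Multiplicative.toAdd (Multiplicative.ofAdd (1 : ZMod (N (lvlC quotV2))))⁻¹ = Multiplicative.toAdd (Multiplicative.ofAdd 1) at key2
  rw [toAdd_inv, toAdd_ofAdd] at key2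
  haveI : Fact (2 < ((N (lvlC quotV2) : ℕ+) : ℕ)) := ⟨by rw [hl]; decide⟩
  exact ZMod.neg_one_ne_one key2

/-- **`cnst` is NOT a constant functor**: the deck transformation `[x] ↦ [x·conjC]` of `Y₂ = Compat/V_2` and the identity have
DIFFERENT images in `D^cnst` (conjugation moves `Spec K_{Y₂} = Spec K(μ_6)`). [cite: MochizukiEtTh2009, Prop 3.4 (ii) p.74] -/
theorem cnst_map_deck_ne_id :
    ∃ f : (quotCoverC (vSub 2) (isOpen_vSub 2) (countable_quotient_vSub 2)) ⟶ (quotCoverC (vSub 2) (isOpen_vSub 2) (countable_quotient_vSub 2)),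
      cnst.map f ≠ cnst.map (𝟙 _) := by
  set quotV2 : ConnectedPart (BTemp Compat) := (quotCoverC (vSub 2) (isOpen_vSub 2) (countable_quotient_vSub 2))
  -- the base point `[x₀]` and the deck transformation `[x] ↦ [x · conjC]`
  obtain ⟨x₀, hx₀⟩ := QuotientGroup.mk_surjective (bpt quotV2)
  have e1 : ∀ x : Compat, (x : Compat ⧸ vSub 2) = (Action.ofMulAction Compat (Compat ⧸ vSub 2)).ρ x ((1 : Compat) : Compat ⧸ vSub 2) :=
    fun x => by rw [Action.ofMulAction_apply, MulAction.Quotient.smul_coe, smul_eq_mul, mul_one]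
  obtain ⟨f₀, hf₀⟩ := BTempConnected.exists_hom_of_stabilizer_le (T₁ := quotV2.obj) (T₂ := quotV2.obj) ((1 : Compat) : Compat ⧸ vSub 2)
    (fun q => by
      induction q using QuotientGroup.induction_on with
      | H g => exact ⟨g, (e1 g).symm⟩)
    ((conjC : Compat) : Compat ⧸ vSub 2) (fun g hg => by
      have hg' := (ofMulAction_quot_fix_iff (vSub 2) 1 g).1 hg
      rw [inv_one, one_mul, mul_one] at hg'
      refine (ofMulAction_quot_fix_iff (vSub 2) conjC g).2 ?_
      have hc := (vSub_normal 2).conj_mem g hg' conjC⁻¹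
      rwa [inv_inv] at hc)
  refine ⟨ObjectProperty.homMk f₀, fun h => toCst_conjC_not_mem_cnstStab ?_⟩
  -- `f([x₀]) = [x₀ conjC]`
  have h1 : f₀.hom.hom (x₀ : Compat ⧸ vSub 2) = ((x₀ * conjC : Compat) : Compat ⧸ vSub 2) := by
    have e := BTempConnected.hom_ρ f₀ x₀ ((1 : Compat) : Compat ⧸ vSub 2)
    rw [hf₀] at e
    change f₀.hom.hom ((Action.ofMulAction Compat (Compat ⧸ vSub 2)).ρ x₀ ((1 : Compat) : Compat ⧸ vSub 2)) =
      (Action.ofMulAction Compat (Compat ⧸ vSub 2)).ρ x₀ ((conjC : Compat) : Compat ⧸ vSub 2) at e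
    rwa [Action.ofMulAction_apply, Action.ofMulAction_apply, MulAction.Quotient.smul_coe, MulAction.Quotient.smul_coe, smul_eq_mul,
      smul_eq_mul, mul_one] at e
  -- transporters: `x₀ conjC x₀⁻¹` for `f`, `1` for the identity
  have hf : (gset quotV2).ρ (x₀ * conjC * x₀⁻¹) (bpt quotV2) = (ObjectProperty.homMk f₀ : quotV2 ⟶ quotV2).hom.hom.hom (bpt quotV2) := by
    rw [← hx₀]
    change (Action.ofMulAction Compat (Compat ⧸ vSub 2)).ρ (x₀ * conjC * x₀⁻¹) (x₀ : Compat ⧸ vSub 2) = f₀.hom.hom (x₀ : Compat ⧸ vSub 2)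
    rw [h1, Action.ofMulAction_apply, MulAction.Quotient.smul_coe, smul_eq_mul, inv_mul_cancel_right]
  have hid : (gset quotV2).ρ 1 (bpt quotV2) = (𝟙 quotV2 : quotV2 ⟶ quotV2).hom.hom.hom (bpt quotV2) := by
    rw [BTempConnected.ρ_one_apply quotV2.obj]; rfl
  have hst := (cnst_map_eq_iff _ _ hf hid).1 h
  rw [mul_one, map_inv, inv_mem_iff, map_mul, map_mul, map_inv, mul_inv_cancel_comm] at hst
  exact hst

end TateTowerKummerTwist

end Literature.AnabelianGeometry.EtaleTheta

end
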